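import Mathlib
import HarnessLib
import Literature.Geometry.Lorentzian.Stationary
import Literature.Geometry.Lorentzian.IPlusRegular
import Literature.Geometry.Lorentzian.Geodesic
import Literature.Geometry.Lorentzian.Einstein
import Literature.Geometry.Lorentzian.Causality
import Literature.Geometry.Lorentzian.CausalityOpennessProofs
import Literature.Geometry.Lorentzian.KillingFlowIsometry
import Literature.Geometry.Lorentzian.KillingOpensJetRigidity
import Summits.FinalStateConjecture.FinalStateConjecture.Theorems.ZeroEnergyKerrOrBombNonTrappingHawkingRigidityStubSlabPatchingKillingUC
import Summits.FinalStateConjecture.FinalStateConjecture.Theorems.ZeroEnergyKerrOrBombNonTrappingHawkingRigidityStubSlabPatchingGradient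
import Summits.FinalStateConjecture.FinalStateConjecture.Theorems.ZeroEnergyKerrOrBombNonTrappingHawkingRigidityStubSlabPatchingBoxes
import Summits.FinalStateConjecture.FinalStateConjecture.Theorems.ZeroEnergyKerrOrBombNonTrappingHawkingRigidityStubSlabPatchingConsistency
import Summits.FinalStateConjecture.FinalStateConjecture.Theorems.ZeroEnergyKerrOrBombNonTrappingHawkingRigidityStubSlabPatchingFlowInvariance
import Summits.FinalStateConjecture.FinalStateConjecture.Theorems.ZeroEnergyKerrOrBombNonTrappingHawkingRigidityStubSlabPatchingTransport
import Summits.FinalStateConjecture.FinalStateConjecture.Theorems.ZeroEnergyKerrOrBombNonTrappingHawkingRigidityStubSlabPatchingSweep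

/-!
# `NonTrappingHawkingRigidity` (crux stmt-FinalStateConjecture-13896), line `Sketch` — stub `stub_slabPatching`

Registered stub S3 of the lead's skeleton `Cruxes/NonTrappingHawkingRigidity/Lines/Sketch.lean`
(namespace `…Cruxes.NonTrappingHawkingRigidity.AzimuthalPartialAnalyticity`, `Holds.stub_slabPatching`),
PROVED. The statement below is the REGISTERED signature, letter for letter (Literature vocabulary only).

**Statement.** Let `𝓑` be an `I⁺`-regular stationary black hole, `f` a `T`-invariant sweep of
the d.o.c. with bottom level `c₀` (smooth on the d.o.c., `df(T) = 0`, spacelike gradient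
`df = g(w, ·)`, `g(w, w) > 0` on `{f ≥ c₀}`, slabs `{c₀ ≤ f ≤ c'}` compact modulo `T`), `c ≥ c₀`,
and `L` a local `T`-commuting Killing field on `{f < c} ∩ doc`. If `({f < c} ∩ doc, L)` has a
one-step continuation at every point of the level `{f = c} ∩ doc`, then there are `ε > 0` and ONE
local `T`-commuting Killing field `L'` on `{f < c + ε} ∩ doc` with `L' = L` on `{f < c} ∩ doc`.

**Proof** (pure differential topology; the helpers are the seven `…StubSlabPatching*.lean` files).
Let `θ` be the smooth global flow of `T` by isometries preserving the d.o.c.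
(`StationaryAFBlackHole.exists_stationary_flow`); `f` is constant along it and its gradient
`Y = grad f` — a `C^∞` field on the d.o.c. (`…Gradient`) with `df(Y) = g(w, w) > 0` on
`{f ≥ c₀}` — is `θ`-invariant (`…Sweep`); `L` is `θ`-invariant on `{f < c} ∩ doc`
(`…FlowInvariance`: local form of Lee's Thm. 9.42, `T ≠ 0` on the d.o.c.). Call a pair `(W, K)`
ADMISSIBLE if `W ⊆ doc` is open and `Y`-SATURATED over the level `c` (every `x ∈ W` with
`f x ≥ c` is the endpoint of an integral curve of `Y` inside `W` starting below the level) and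
`K` is a local `T`-commuting Killing field on `W` with `K = L` on `W ∩ {f < c}`. (1) Every
continuation `(W_q, L_q)` at a point `q` of the level contains an admissible `(B, L_q)` with
`q ∈ B` (`…Boxes`: flow box of `Y`). (2) Two admissible pairs agree on the intersection of their
domains (`…Consistency`: the descending `Y`-curves from a common point coincide, so every
component of the intersection meets `{f < c}`; unique continuation of the local Killing field
`K₁ - K₂`, `…KillingUC`). (3) `θ_t` maps admissible pairs to admissible pairs (`…Transport`).
Hence the union `N` of all admissible domains is an open `θ`-invariant neighbourhood of the level
inside the d.o.c. carrying ONE field `L'` (glued from the admissible pairs, `= L` below the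
level), which is a local `T`-commuting Killing field on `N ∪ ({f < c} ∩ doc)` (locality of
smoothness, of the Levi-Civita connection and of the bracket). (4) By compactness of the slab
`{c₀ ≤ f ≤ c + 1}` modulo `T` and `θ`-invariance of `N`, `{c ≤ f < c + ε} ∩ doc ⊆ N` for some
`ε > 0` (`…Sweep`, `stub_slabPatching_eps`; this also covers an empty level). References:
O'Neill 1983, Ch. 9, Lemma 9.28 and Prop. 9.23; Lee 2012, Thms. 9.12, 9.22, 9.42;
Chruściel–Costa 2008, §2.2 and Cor. 3.8.
-/

noncomputable section

-- D-0017: single-problem summit, `Summit.<S>.<S>.…` by design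
set_option linter.dupNamespace false

namespace Summit.FinalStateConjecture.FinalStateConjecture.Theorems.NonTrappingHawkingRigidity.AzimuthalPartialAnalyticity

open Set Filter Function Bundle Literature.Geometry.Lorentzian
open Summit.FinalStateConjecture.FinalStateConjecture.Theorems.NonTrappingHawkingRigidity.AzimuthalPartialAnalyticity.SlabPatching
open scoped Manifold ContDiff Topology

/-- **Gluing / locality of local `T`-commuting Killing fields.** If at every point of `Z` the
field `L'` agrees, on an open neighbourhood, with some field which is `C^∞`, satisfies the
Killing equation and commutes with `T` there, then `L'` has these three properties on `Z`
(smoothness, the Levi-Civita connection — `leviCivita_congr_nhds` — and the bracket are local in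
the germ of the field). Copy of the lead's `IsLocalKilling.of_locally` (skeleton §2), unbundled.
[folklore] -/
theorem localKilling_of_locally (𝓑 : StationaryAFBlackHole.{0}) [𝓑.metric.HasLeviCivita]
    {Z : Set 𝓑.carrier} {L' : Π x : 𝓑.carrier, TangentSpace (𝓡 4) x}
    (h : ∀ x ∈ Z, ∃ (O : Set 𝓑.carrier) (K : Π x : 𝓑.carrier, TangentSpace (𝓡 4) x),
      IsOpen O ∧ x ∈ O ∧
      ContMDiffOn (𝓡 4) ((𝓡 4).prod 𝓘(ℝ, E4)) ∞
        (fun x ↦ (TotalSpace.mk' E4 x (K x) : TangentBundle (𝓡 4) 𝓑.carrier)) O ∧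
      (∀ y ∈ O, ∀ v w : TangentSpace (𝓡 4) y,
        𝓑.metric.val y (𝓑.metric.leviCivita K y v) w +
          𝓑.metric.val y v (𝓑.metric.leviCivita K y w) = 0) ∧
      (∀ y ∈ O, VectorField.mlieBracket (𝓡 4) 𝓑.killing K y = 0) ∧
      ∀ y ∈ O, L' y = K y) :
    ContMDiffOn (𝓡 4) ((𝓡 4).prod 𝓘(ℝ, E4)) ∞
        (fun x ↦ (TotalSpace.mk' E4 x (L' x) : TangentBundle (𝓡 4) 𝓑.carrier)) Z ∧
      (∀ x ∈ Z, ∀ v w : TangentSpace (𝓡 4) x,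
        𝓑.metric.val x (𝓑.metric.leviCivita L' x v) w +
          𝓑.metric.val x v (𝓑.metric.leviCivita L' x w) = 0) ∧
      ∀ x ∈ Z, VectorField.mlieBracket (𝓡 4) 𝓑.killing L' x = 0 := by
  refine ⟨fun x hx ↦ ?_, fun x hx v w ↦ ?_, fun x hx ↦ ?_⟩
  · obtain ⟨O, K, hO, hxO, hKs, -, -, hagree⟩ := h x hx
    have hOn : O ∈ 𝓝 x := hO.mem_nhds hxO
    have hev : (fun y ↦ (TotalSpace.mk' E4 y (L' y) : TangentBundle (𝓡 4) 𝓑.carrier)) =ᶠ[𝓝 x]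
        (fun y ↦ (TotalSpace.mk' E4 y (K y) : TangentBundle (𝓡 4) 𝓑.carrier)) := by
      filter_upwards [hOn] with y hy
      rw [hagree y hy]
    exact (((hKs x hxO).contMDiffAt hOn).congr_of_eventuallyEq hev).contMDiffWithinAt
  · obtain ⟨O, K, hO, hxO, -, hKk, -, hagree⟩ := h x hx
    have hev : L' =ᶠ[𝓝 x] K := by
      filter_upwards [hO.mem_nhds hxO] with y hy using hagree y hy
    rw [leviCivita_congr_nhds 𝓑.metric.toPseudoRiemannianMetric hev]
    exact hKk x hxO v w
  · obtain ⟨O, K, hO, hxO, -, -, hKb, hagree⟩ := h x hx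
    have hev : L' =ᶠ[𝓝 x] K := by
      filter_upwards [hO.mem_nhds hxO] with y hy using hagree y hy
    rw [(EventuallyEq.rfl (f := 𝓑.killing)).mlieBracket_vectorField_eq hev]
    exact hKb x hxO

/-- **Stub S3 `stub_slabPatching` (registered signature, letter for letter): pointwise
continuations along a level of a `T`-invariant timelike sweep patch to ONE continuation on a
uniform slab** — see the module docstring for the statement in words and the proof (admissible
gradient-saturated boxes, consistency by unique continuation of Killing fields, transport by the
stationary isometries, uniform `ε` by compactness modulo `T`). O'Neill 1983, Ch. 9, Lemma 9.28
and Prop. 9.23; Lee 2012, Thms. 9.22 and 9.42. [cite: ONeill1983, Ch. 9, Lemma 9.28] -/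
theorem stub_slabPatching :
    ∀ (𝓑 : StationaryAFBlackHole.{0}) [𝓑.metric.HasLeviCivita], 𝓑.IsIPlusRegular →
      ∀ (U' : Set 𝓑.carrier) (f : 𝓑.carrier → ℝ) (c₀ : ℝ),
      (ContMDiffOn (𝓡 4) 𝓘(ℝ, ℝ) ((⊤ : ℕ∞) : WithTop ℕ∞) f 𝓑.doc ∧
        (∀ x ∈ 𝓑.doc, mfderiv (𝓡 4) 𝓘(ℝ, ℝ) f x (𝓑.killing x) = 0) ∧
        {x | x ∈ 𝓑.doc ∧ f x < c₀} = U' ∩ 𝓑.doc ∧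
        (∀ x ∈ 𝓑.doc, c₀ ≤ f x → ∃ w : TangentSpace (𝓡 4) x, 0 < 𝓑.metric.val x w w ∧
          ∀ u : TangentSpace (𝓡 4) x, mfderiv (𝓡 4) 𝓘(ℝ, ℝ) f x u = 𝓑.metric.val x w u) ∧
        ∀ c : ℝ, ∃ S : Set 𝓑.carrier, IsCompact S ∧ S ⊆ 𝓑.doc ∧
          {x | x ∈ 𝓑.doc ∧ c₀ ≤ f x ∧ f x ≤ c} ⊆ stationaryOrbit 𝓑.killing S) →
      ∀ c : ℝ, c₀ ≤ c → ∀ L : Π x : 𝓑.carrier, TangentSpace (𝓡 4) x,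
      (ContMDiffOn (𝓡 4) ((𝓡 4).prod 𝓘(ℝ, E4)) ((⊤ : ℕ∞) : WithTop ℕ∞)
          (fun x ↦ (Bundle.TotalSpace.mk' E4 x (L x) : TangentBundle (𝓡 4) 𝓑.carrier)) {x | x ∈ 𝓑.doc ∧ f x < c} ∧
        (∀ x ∈ {x | x ∈ 𝓑.doc ∧ f x < c}, ∀ v w : TangentSpace (𝓡 4) x,
          𝓑.metric.val x (𝓑.metric.leviCivita L x v) w + 𝓑.metric.val x v (𝓑.metric.leviCivita L x w) = 0) ∧
        ∀ x ∈ {x | x ∈ 𝓑.doc ∧ f x < c}, VectorField.mlieBracket (𝓡 4) 𝓑.killing L x = 0) →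
      (∀ q ∈ 𝓑.doc, f q = c →
        (∃ (W : Set 𝓑.carrier) (L' : Π x : 𝓑.carrier, TangentSpace (𝓡 4) x),
          IsOpen W ∧ q ∈ W ∧ W ⊆ 𝓑.doc ∧
          (ContMDiffOn (𝓡 4) ((𝓡 4).prod 𝓘(ℝ, E4)) ((⊤ : ℕ∞) : WithTop ℕ∞)
              (fun x ↦ (Bundle.TotalSpace.mk' E4 x (L' x) : TangentBundle (𝓡 4) 𝓑.carrier)) W ∧
            (∀ x ∈ W, ∀ v w : TangentSpace (𝓡 4) x,
              𝓑.metric.val x (𝓑.metric.leviCivita L' x v) w + 𝓑.metric.val x v (𝓑.metric.leviCivita L' x w) = 0) ∧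
            ∀ x ∈ W, VectorField.mlieBracket (𝓡 4) 𝓑.killing L' x = 0) ∧
          ∀ x ∈ W ∩ {x | x ∈ 𝓑.doc ∧ f x < c}, L' x = L x)) →
      ∃ ε : ℝ, 0 < ε ∧ ∃ L' : Π x : 𝓑.carrier, TangentSpace (𝓡 4) x,
        (ContMDiffOn (𝓡 4) ((𝓡 4).prod 𝓘(ℝ, E4)) ((⊤ : ℕ∞) : WithTop ℕ∞)
            (fun x ↦ (Bundle.TotalSpace.mk' E4 x (L' x) : TangentBundle (𝓡 4) 𝓑.carrier)) {x | x ∈ 𝓑.doc ∧ f x < c + ε} ∧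
          (∀ x ∈ {x | x ∈ 𝓑.doc ∧ f x < c + ε}, ∀ v w : TangentSpace (𝓡 4) x,
            𝓑.metric.val x (𝓑.metric.leviCivita L' x v) w + 𝓑.metric.val x v (𝓑.metric.leviCivita L' x w) = 0) ∧
          ∀ x ∈ {x | x ∈ 𝓑.doc ∧ f x < c + ε}, VectorField.mlieBracket (𝓡 4) 𝓑.killing L' x = 0) ∧
        ∀ x ∈ {x | x ∈ 𝓑.doc ∧ f x < c}, L' x = L x := by
  intro 𝓑 _ hreg U' f c₀ hsweep c hc L hL hcont
  classical
  obtain ⟨hf, hfT, -, hgrad, hslab⟩ := hsweep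
  obtain ⟨hLs, hLk, hLb⟩ := hL
  -- the stationary flow by isometries, preserving the d.o.c.; `f` is constant along it
  obtain ⟨θ, hθ, hθ0, hθadd, hθT, hiso, -, -, -, -, hdocinv, -, -⟩ := 𝓑.exists_stationary_flow
  have hdoc : ∀ p ∈ 𝓑.doc, ∀ s : ℝ, θ (s, p) ∈ 𝓑.doc := fun p hp s ↦ by
    rw [← hdocinv s]; exact mem_image_of_mem _ hp
  have hdoco : IsOpen 𝓑.doc :=
    𝓑.isOpen_doc LorentzianMetric.isOpen_chronologicalFuture_holds_of_boundaryless
      LorentzianMetric.isOpen_chronologicalPast_holds_of_boundaryless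
  have hfc : ContinuousOn f 𝓑.doc := hf.continuousOn
  have hfinv : ∀ p ∈ 𝓑.doc, ∀ s : ℝ, f (θ (s, p)) = f p := sweep_flow_invariant hθ0 hθT hdoc hf hfT
  -- the known side `V = {f < c} ∩ doc`: open, flow-invariant; `L` is flow-invariant on it
  have hVo : IsOpen {x | x ∈ 𝓑.doc ∧ f x < c} := hfc.isOpen_inter_preimage hdoco isOpen_Iio
  have hVinv : ∀ p ∈ {x | x ∈ 𝓑.doc ∧ f x < c}, ∀ s : ℝ, θ (s, p) ∈ {x | x ∈ 𝓑.doc ∧ f x < c} :=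
    fun p hp s ↦ ⟨hdoc p hp.1 s, by rw [hfinv p hp.1 s]; exact hp.2⟩
  have hLinv := stub_slabPatching_flowInvariance 𝓑 hreg θ {x | x ∈ 𝓑.doc ∧ f x < c} L hθ hθ0
    hθadd hθT hVo (fun x hx ↦ hx.1) hVinv hLs hLb
  -- the gradient `Y = grad f`: smooth on the d.o.c., flow-invariant, `df(Y) > 0` on `{f ≥ c₀}`
  obtain ⟨hYs, -, hYeq⟩ := stub_slabPatching_gradient 𝓑 𝓑.doc f hdoco hf
  have hYinv := sharp_mvfderiv_flow_invariant hθ hθ0 hθadd hiso hdoc hf hfinv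
  have hYpos : ∀ q ∈ 𝓑.doc, c₀ ≤ f q →
      0 < mvfderiv (𝓡 4) f q (𝓑.metric.sharp q (mvfderiv (𝓡 4) f q).toLinearMap) := by
    intro q hq hcq
    obtain ⟨w, hw, hdw⟩ := hgrad q hq hcq
    rw [hYeq q w hdw]
    show 0 < (show ℝ from mfderiv (𝓡 4) 𝓘(ℝ, ℝ) f q w)
    rw [hdw w]
    exact hw
  -- ADMISSIBLE pairs `(W, K)`
  set Adm : Set 𝓑.carrier → (Π x : 𝓑.carrier, TangentSpace (𝓡 4) x) → Prop := fun W K ↦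
    IsOpen W ∧ W ⊆ 𝓑.doc ∧
      (∀ x ∈ W, c ≤ f x → ∃ (γ : ℝ → 𝓑.carrier) (a a' b' : ℝ), a' < a ∧ a < 0 ∧ 0 < b' ∧
        γ 0 = x ∧
        IsMIntegralCurveOn γ
          (fun x ↦ (𝓑.metric.sharp x (mvfderiv (𝓡 4) f x).toLinearMap : TangentSpace (𝓡 4) x))
          (Set.Ioo a' b') ∧
        (∀ s ∈ Set.Ioo a' b', γ s ∈ W) ∧ f (γ a) < c) ∧
      ContMDiffOn (𝓡 4) ((𝓡 4).prod 𝓘(ℝ, E4)) ((⊤ : ℕ∞) : WithTop ℕ∞)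
        (fun x ↦ (Bundle.TotalSpace.mk' E4 x (K x) : TangentBundle (𝓡 4) 𝓑.carrier)) W ∧
      (∀ x ∈ W, ∀ v w : TangentSpace (𝓡 4) x,
        𝓑.metric.val x (𝓑.metric.leviCivita K x v) w +
          𝓑.metric.val x v (𝓑.metric.leviCivita K x w) = 0) ∧
      (∀ x ∈ W, VectorField.mlieBracket (𝓡 4) 𝓑.killing K x = 0) ∧
      ∀ x ∈ W, f x < c → K x = L x with hAdm
  -- (2) consistency of admissible pairs
  have hcons : ∀ W₁ K₁ W₂ K₂, Adm W₁ K₁ → Adm W₂ K₂ → ∀ x ∈ W₁ ∩ W₂, K₁ x = K₂ x := by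
    intro W₁ K₁ W₂ K₂ h₁ h₂
    obtain ⟨h₁o, h₁d, h₁S, h₁s, h₁k, -, h₁L⟩ := h₁
    obtain ⟨h₂o, -, h₂S, h₂s, h₂k, -, h₂L⟩ := h₂
    exact stub_slabPatching_consistency 𝓑 𝓑.doc W₁ W₂ f c _ L K₁ K₂ hdoco hfc hYs h₁o h₂o h₁d
      h₁S h₂S h₁s h₁k h₁L h₂s h₂k h₂L
  -- (3) transport of admissible pairs
  have htrans : ∀ W K, Adm W K → ∀ s : ℝ,
      Adm ((fun q ↦ θ (s, q)) '' W) (VectorField.mpullback (𝓡 4) (𝓡 4) (fun q ↦ θ (-s, q)) K) :=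
    fun W K hWK s ↦ stub_slabPatching_transport 𝓑 θ f c s _ L K W hθ hθ0 hθadd hθT hiso hdoc hfinv
      hYinv hLinv hWK
  -- the glued domain `N` and field `L'`
  set N : Set 𝓑.carrier := {x | ∃ (W : Set 𝓑.carrier)
    (K : Π x : 𝓑.carrier, TangentSpace (𝓡 4) x), Adm W K ∧ x ∈ W} with hN
  set L' : Π x : 𝓑.carrier, TangentSpace (𝓡 4) x := fun x ↦
    if h : ∃ p : Set 𝓑.carrier × (Π y : 𝓑.carrier, TangentSpace (𝓡 4) y), Adm p.1 p.2 ∧ x ∈ p.1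
    then (Classical.choose h).2 x else L x with hL'
  have hagree : ∀ W K, Adm W K → ∀ x ∈ W, L' x = K x := by
    intro W K hWK x hx
    have h : ∃ p : Set 𝓑.carrier × (Π y : 𝓑.carrier, TangentSpace (𝓡 4) y),
        Adm p.1 p.2 ∧ x ∈ p.1 := ⟨(W, K), hWK, hx⟩
    have hL'x : L' x = (Classical.choose h).2 x := by simp only [hL', dif_pos h]
    rw [hL'x]
    obtain ⟨hp, hxp⟩ := Classical.choose_spec h
    exact hcons _ _ _ _ hp hWK x ⟨hxp, hx⟩
  have hLV : ∀ x ∈ {x | x ∈ 𝓑.doc ∧ f x < c}, L' x = L x := by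
    intro x hx
    by_cases h : ∃ p : Set 𝓑.carrier × (Π y : 𝓑.carrier, TangentSpace (𝓡 4) y),
        Adm p.1 p.2 ∧ x ∈ p.1
    · have hL'x : L' x = (Classical.choose h).2 x := by simp only [hL', dif_pos h]
      rw [hL'x]
      obtain ⟨hp, hxp⟩ := Classical.choose_spec h
      exact hp.2.2.2.2.2.2 x hxp hx.2
    · simp only [hL', dif_neg h]
  have hNo : IsOpen N := by
    rw [isOpen_iff_mem_nhds]
    rintro x ⟨W, K, hWK, hxW⟩
    exact mem_of_superset (hWK.1.mem_nhds hxW) fun y hy ↦ ⟨W, K, hWK, hy⟩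
  have hNinv : ∀ p ∈ N, ∀ s : ℝ, θ (s, p) ∈ N := by
    rintro p ⟨W, K, hWK, hpW⟩ s
    exact ⟨_, _, htrans W K hWK s, mem_image_of_mem _ hpW⟩
  -- (1) the level `{f = c} ∩ doc` lies in `N`
  have hlevN : ∀ q ∈ 𝓑.doc, f q = c → q ∈ N := by
    intro q hq hfq
    obtain ⟨W, Lq, hWo, hqW, hWdoc, ⟨hLqs, hLqk, hLqb⟩, hLqL⟩ := hcont q hq hfq
    obtain ⟨B, hBo, hqB, hBW, hSB⟩ := stub_slabPatching_boxes 𝓑 W f c _ q hWo hqW hfq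
      (hf.mono hWdoc) (hYs.mono hWdoc) (hYpos q hq (by rw [hfq]; exact hc))
    refine ⟨B, Lq, ⟨hBo, hBW.trans hWdoc, hSB, hLqs.mono hBW, fun x hx ↦ hLqk x (hBW hx),
      fun x hx ↦ hLqb x (hBW hx), fun x hx hfx ↦ hLqL x ⟨hBW hx, hWdoc (hBW hx), hfx⟩⟩, hqB⟩
  -- (4) the uniform `ε`
  obtain ⟨ε, hε, hεN⟩ := stub_slabPatching_eps 𝓑 θ f c₀ c N hθ0 hθT hdoc hfc hfinv hc
    (hslab (c + 1)) hNo hNinv hlevN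
  -- conclusion: `L'` is a local `T`-commuting Killing field on `{f < c + ε} ∩ doc ⊆ V ∪ N`
  refine ⟨ε, hε, L', localKilling_of_locally 𝓑 (fun x hx ↦ ?_), hLV⟩
  by_cases hfx : f x < c
  · exact ⟨{x | x ∈ 𝓑.doc ∧ f x < c}, L, hVo, ⟨hx.1, hfx⟩, hLs, hLk, hLb, hLV⟩
  · push Not at hfx
    obtain ⟨W, K, hWK, hxW⟩ := hεN x hx.1 hfx hx.2
    exact ⟨W, K, hWK.1, hxW, hWK.2.2.2.1, hWK.2.2.2.2.1, hWK.2.2.2.2.2.1, hagree W K hWK⟩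

end Summit.FinalStateConjecture.FinalStateConjecture.Theorems.NonTrappingHawkingRigidity.AzimuthalPartialAnalyticity

end

-- WORKLOG (S3 worker, 2026-08-17)
-- * sanity check: statement TRUE and well-stated (no junk values; empty level covered by the ε-lemma).
-- * helpers landed/proposed under Theorems/ZeroEnergyKerrOrBombNonTrappingHawkingRigidityStubSlabPatching*.lean:
--   KillingUC (p136779, unique continuation of local Killing fields on an abstract manifold),
--   Gradient (smooth gradient field), Boxes (gradient-saturated boxes, flow box), Consistency
--   (continuations agree on saturated boxes), FlowInvariance (local Lee 9.42), Transport (admissible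
--   pairs under the stationary isometries), Sweep (f and grad f flow-invariant; uniform ε mod T).
-- * each helper carries one registered sub-stub `stub_slabPatching_<name>` (ledger workitem stub-add).
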